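import Literature.AlgebraicTopology.SingularHomology.ExcisionTheorem
import Literature.AlgebraicTopology.SingularHomology.ExcisionMayerVietorisProofs
import Literature.AlgebraicTopology.SingularHomology.NoncompactManifoldProofs
import Literature.AlgebraicTopology.SingularHomology.Orientation
import Mathlib.Analysis.Convex.Contractible
import HarnessLib

/-!
# Local homology of a manifold off the top degree: discharge of the named fact
`Literature.AlgebraicTopology.SingularHomology.isZero_localHomology` (spaces in `Type`)

`Literature.AlgebraicTopology.SingularHomology.Orientation` states as a **named fact** (D-0014)
`Literature.isZero_localHomology R M X`: on a topological `n`-manifold `X`, `Hₖ(X | x; M) = 0` for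
`k ≠ n` (A. Hatcher, *Algebraic Topology*, CUP 2002, §3.3, p. 231: "`Hₖ(M | x) ≅ Hₖ(ℝⁿ | 0)`
by excision, and `Hₖ(ℝⁿ, ℝⁿ - {0}) ≅ H̃ₖ₋₁(Sⁿ⁻¹)` by the long exact sequence, `ℝⁿ` being
contractible"). Here it is **proved** for every space `X : Type`, commutative ring `R` and
`R`-module `M` (`Literature.AlgebraicTopology.SingularHomology.isZero_localHomology_holds`; `X` lives in `Type` because the chart-by-chart
transport compares `X` with `ℝⁿ : Type` by induced maps of singular homology, which requires one
universe — the convention of `…NoncompactManifoldProofs`).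

The proof is Hatcher's, on Mathlib's model `Literature.AlgebraicTopology.SingularHomology.relativeSingularHomology`:

* `Literature.AlgebraicTopology.SingularHomology.localHomology.isIso_map_subsetIncl_of_isOpen` — **excision for local homology**:
  `Hₖ(O | x) ≅ Hₖ(X | x)` for `O` open, `x ∈ O` (Thm. 2.20, proved in `…ExcisionTheorem`);
* `Literature.AlgebraicTopology.SingularHomology.isZero_relativeSingularHomology_zero_of_pathConnectedSpace` — `H₀(X, A) = 0` for `X`
  path-connected and `A ≠ ∅` (the end `H₀(A) ↠ H₀(X) ↠ H₀(X, A) → 0` of the long exact sequence);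
* `Literature.AlgebraicTopology.SingularHomology.isZero_localHomology_rvec` — `Hₖ(ℝⁿ | p; M) = 0` for `k ≠ n`: the long exact sequence of
  `(ℝⁿ, ℝⁿ ∖ p)` with `ℝⁿ` contractible and `Hⱼ(ℝⁿ ∖ 0) = 0` for `1 ≤ j ≠ n - 1`
  (`Literature.AlgebraicTopology.SingularHomology.isZero_homology_punctured_of_succ_ne`, `…ExcisionMayerVietorisProofs`), `ℝⁿ ∖ 0`
  path-connected for `n ≥ 2` (degree `1`) and nonempty for `n ≥ 1` (degree `0`);
* `Literature.AlgebraicTopology.SingularHomology.isZero_localHomology_of_chart` — transport along a chart `e : X ⇀ ℝⁿ` through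
  `Hₖ(X | x) ≅ Hₖ(e.source | x) ≅ Hₖ(e.target | e x) ≅ Hₖ(ℝⁿ | e x)`;
* `Literature.isZero_localHomology_holds (X : Type)`.

Everything is proved. The only new data is the excision isomorphism
`Literature.AlgebraicTopology.SingularHomology.localHomology.openSubsetIso` (`Hₖ(O | x) ≅ Hₖ(X | x)` for `O` open, packaged with `asIso`);
there are no new named facts and no new instances.

## References

* A. Hatcher, *Algebraic Topology*, CUP 2002, §2.1 (Thm. 2.13 ff., Thm. 2.20), §3.3 p. 231
  [HatcherAT2002].
-/

noncomputable section

open CategoryTheory Limits Set Topology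

universe u v

namespace Literature.AlgebraicTopology.SingularHomology

variable (R : Type v) [CommRing R] (M : Type v) [AddCommGroup M] [Module R M]

/-! ### Excision for local homology at an open subspace -/

section OpenExcision

variable {X : Type u} [TopologicalSpace X]

namespace relativeSingularHomology

/-- The map of pairs `(X, A) → (X, B)` given by the identity is an isomorphism on relative
homology when `A = B` (transport along an equality of subspaces). [folklore] -/
lemma isIso_map_id_of_eq {A B : Set X} (h : A = B) (hAB : Set.MapsTo (ContinuousMap.id X) A B)
    (n : ℕ) : IsIso (map R M (ContinuousMap.id X) hAB n) := by
  subst h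
  rw [map_id]
  infer_instance

end relativeSingularHomology

namespace localHomology

/-- The inclusion of an open subspace `O ∋ x` as a map of pairs `(O, O ∖ x) → (X, X ∖ x)` sends
`O ∖ x` into `X ∖ x`. [folklore] -/
lemma mapsTo_subsetIncl_compl {O : Set X} {x : X} (hx : x ∈ O) :
    Set.MapsTo (subsetIncl O) ({(⟨x, hx⟩ : O)}ᶜ : Set O) ({x}ᶜ : Set X) := by
  intro y hy h
  exact hy (Subtype.ext h)

/-- **Excision for local homology** (Hatcher 2002, Thm. 2.20 / §3.3 p. 231: "`Hₖ(X | x)` depends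
only on a neighbourhood of `x`"): for `O` open and `x ∈ O`, the inclusion `(O, O ∖ x) ↪ (X, X ∖ x)`
induces isomorphisms `Hₖ(O | x; M) ≅ Hₖ(X | x; M)`. The interiors of `X ∖ {x}` and `O` cover `X`,
so this is the excision theorem proved in `…ExcisionTheorem`. [cite: HatcherAT2002, Thm. 2.20] -/
theorem isIso_map_subsetIncl_of_isOpen [T1Space X] {O : Set X} (hO : IsOpen O) {x : X}
    (hx : x ∈ O) (k : ℕ) :
    IsIso (relativeSingularHomology.map R M (subsetIncl O) (mapsTo_subsetIncl_compl hx) k) := by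
  have hcov : interior ({x}ᶜ : Set X) ∪ interior O = Set.univ := by
    rw [hO.interior_eq, (isOpen_compl_singleton (x := x)).interior_eq]
    refine Set.eq_univ_of_forall fun y => ?_
    by_cases hy : y = x
    · exact Or.inr (hy ▸ hx)
    · exact Or.inl (Set.mem_compl_singleton_iff.mpr hy)
  have h1 := relativeSingularHomology.isIso_map_of_interior_union_interior_holds R M X {x}ᶜ O hcov k
  have heq : ({(⟨x, hx⟩ : O)}ᶜ : Set O) = Subtype.val ⁻¹' {x}ᶜ := by
    ext y
    simp only [Set.mem_compl_iff, Set.mem_singleton_iff, Set.mem_preimage, Subtype.ext_iff]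
  have hid : Set.MapsTo (ContinuousMap.id O) ({(⟨x, hx⟩ : O)}ᶜ : Set O) (Subtype.val ⁻¹' {x}ᶜ) :=
    fun y hy => heq ▸ hy
  haveI := relativeSingularHomology.isIso_map_id_of_eq R M heq hid k
  have hfac : relativeSingularHomology.map R M (subsetIncl O) (mapsTo_subsetIncl_compl hx) k =
      relativeSingularHomology.map R M (ContinuousMap.id O) hid k ≫
        relativeSingularHomology.map R M (subsetIncl O) (Set.mapsTo_preimage Subtype.val {x}ᶜ) k := by
    rw [← relativeSingularHomology.map_comp]
    rfl
  rw [hfac]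
  haveI := h1
  infer_instance

/-- `Hₖ(O | x; M) ≅ Hₖ(X | x; M)` for `O` open, `x ∈ O`, as an isomorphism (Hatcher 2002, §3.3,
p. 231). [cite: HatcherAT2002, Thm. 2.20] -/
def openSubsetIso [T1Space X] {O : Set X} (hO : IsOpen O) {x : X} (hx : x ∈ O) (k : ℕ) :
    localHomology R M (↥O) ⟨x, hx⟩ k ≅ localHomology R M X x k :=
  haveI := isIso_map_subsetIncl_of_isOpen R M hO hx k
  asIso (relativeSingularHomology.map R M (subsetIncl O) (mapsTo_subsetIncl_compl hx) k)

end localHomology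

end OpenExcision

/-! ### `H₀(X, A) = 0` for `X` path-connected and `A` nonempty -/

section DegreeZero

variable {X Y : Type u} [TopologicalSpace X] [TopologicalSpace Y]

/-- For a nonempty space the augmentation `ε : H₀(X; M) ⟶ M` is an epimorphism: it is already
an isomorphism on `H₀` of a point of `X` (Hatcher 2002, Prop. 2.7 / Prop. 2.8). [folklore] -/
theorem singularHomology.epi_ε_of_nonempty [Nonempty X] : Epi (singularHomology.ε R M X) := by
  obtain ⟨x⟩ := ‹Nonempty X›
  let g : C(PUnit.{u + 1}, X) := ContinuousMap.const _ x
  haveI : IsIso (singularHomology.ε R M PUnit.{u + 1}) :=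
    singularHomology.isIso_ε_of_pathConnectedSpace R M
  have h := singularHomology.map_ε (R := R) (M := M) g
  exact epi_of_epi_fac h

/-- A map from a nonempty space to a path-connected space is surjective on `H₀` (Hatcher 2002,
Prop. 2.7: both augmentations are compatible, the target's is an isomorphism). [folklore] -/
theorem singularHomology.epi_map_zero_of_pathConnectedSpace [Nonempty X] [PathConnectedSpace Y]
    (f : C(X, Y)) : Epi (singularHomology.map R M f 0) := by
  haveI : IsIso (singularHomology.ε R M Y) := singularHomology.isIso_ε_of_pathConnectedSpace R M
  haveI := singularHomology.epi_ε_of_nonempty R M (X := X)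
  have h : singularHomology.map R M f 0 =
      singularHomology.ε R M X ≫ inv (singularHomology.ε R M Y) := by
    rw [← singularHomology.map_ε (R := R) (M := M) f, Category.assoc, IsIso.hom_inv_id,
      Category.comp_id]
  rw [h]
  infer_instance

/-- `j_* : H₀(X; M) ⟶ H₀(X, A; M)` is an epimorphism (the long exact sequence of the pair ends with
`H₀(X) → H₀(X, A) → 0`; Hatcher 2002, §2.1, Thm. 2.13 ff.): the quotient map of chain complexes is
degreewise surjective and degree `0` has no outgoing differential. [folklore] -/
theorem relativeSingularHomology.epi_ofAbsolute_zero (A : Set X) :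
    Epi (relativeSingularHomology.ofAbsolute R M X A 0) := by
  haveI := relativeSingularChainComplex.epi_π R M (X := X) A
  exact HomologicalComplex.epi_homologyMap_of_epi_of_not_rel _ 0 (fun j h => by
    simp only [ComplexShape.down_Rel] at h; omega)

/-- **`H₀(X, A; M) = 0` for `X` path-connected and `A` nonempty** (Hatcher 2002, §2.1, from the
long exact sequence: `H₀(A) → H₀(X)` is onto and `H₀(X) → H₀(X, A)` is onto). [folklore] -/
theorem isZero_relativeSingularHomology_zero_of_pathConnectedSpace [PathConnectedSpace X]
    (A : Set X) (hA : A.Nonempty) : IsZero (relativeSingularHomology R M X A 0) := by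
  haveI : Nonempty A := hA.to_subtype
  haveI := singularHomology.epi_map_zero_of_pathConnectedSpace R M (subsetIncl A)
  haveI := relativeSingularHomology.epi_ofAbsolute_zero R M (X := X) A
  have hzero : relativeSingularHomology.ofAbsolute R M X A 0 = 0 := by
    rw [← cancel_epi (singularHomology.map R M (subsetIncl A) 0),
      relativeSingularHomology.map_comp_ofAbsolute, comp_zero]
  exact IsZero.of_epi_eq_zero (relativeSingularHomology.ofAbsolute R M X A 0) hzero

end DegreeZero

/-! ### The local homology of `ℝⁿ` -/

section Euclidean

variable {n : ℕ}

/-- `Hⱼ(ℝⁿ ∖ p; M) = 0` for `1 ≤ j` and `j + 1 ≠ n`, Mathlib's model (from the concrete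
computation `Literature.AlgebraicTopology.SingularHomology.isZero_homology_punctured_of_succ_ne`, Hatcher 2002, Cor. 2.14, transported
along the translation `Literature.complSingletonHomeomorph p : ℝⁿ ∖ p ≃ₜ ℝⁿ ∖ 0` of `…PuncturedEuclidean`).
[cite: HatcherAT2002, Cor. 2.14] -/
theorem isZero_singularHomology_compl_singleton_rvec (p : RVec n) {j : ℕ} (hj : 1 ≤ j)
    (hjn : j + 1 ≠ n) : IsZero (singularHomology R M ↥(({p}ᶜ : Set (RVec n))) j) :=
  ((isZero_homology_punctured_of_succ_ne R M j n hj hjn).of_iso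
    (csingularHomology.compIso R M _ j).symm).of_iso
      (singularHomology.mapIso R M (complSingletonHomeomorph p) j)

/-- `ℝⁿ ∖ {p}` is path-connected for `n ≥ 2` (a theorem, used as a local instance below).
[folklore] -/
theorem pathConnectedSpace_compl_singleton_rvec (p : RVec n) (hn : 2 ≤ n) :
    PathConnectedSpace ↥(({p}ᶜ : Set (RVec n))) := by
  refine isPathConnected_iff_pathConnectedSpace.mp ?_
  refine isPathConnected_compl_singleton_of_one_lt_rank ?_ p
  rw [rank_fin_fun]
  exact_mod_cast hn

/-- **`Hₖ(ℝⁿ | p; M) = 0` for `k ≠ n`** (Hatcher 2002, §3.3, p. 231 with Cor. 2.14: the long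
exact sequence of the pair `(ℝⁿ, ℝⁿ ∖ p)` gives `Hₖ(ℝⁿ, ℝⁿ ∖ p) ≅ H̃ₖ₋₁(ℝⁿ ∖ p) ≅ H̃ₖ₋₁(Sⁿ⁻¹)`,
`ℝⁿ` being contractible). [cite: HatcherAT2002, §3.3 p. 231] -/
theorem isZero_localHomology_rvec (p : RVec n) {k : ℕ} (hk : k ≠ n) :
    IsZero (localHomology R M (RVec n) p k) := by
  -- the absolute groups of `ℝⁿ` vanish in positive degrees
  have hX : ∀ i, i ≠ 0 → IsZero (singularHomology R M (RVec n) i) := fun i hi =>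
    isZero_singularHomology_of_contractibleSpace R M hi
  rcases k with _ | k
  · -- degree `0`: `n ≥ 1`, `ℝⁿ ∖ p` is nonempty and `ℝⁿ` is path-connected
    have hne : (({p}ᶜ : Set (RVec n))).Nonempty := by
      obtain ⟨i⟩ : Nonempty (Fin n) := ⟨⟨0, Nat.pos_of_ne_zero (Ne.symm hk)⟩⟩
      refine ⟨p + Pi.single i 1, ?_⟩
      rw [Set.mem_compl_singleton_iff, Ne, add_eq_left]
      intro h
      have := congrFun h i
      simp at this
    exact isZero_relativeSingularHomology_zero_of_pathConnectedSpace R M _ hne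
  · -- degree `k + 1`: `∂ : Hₖ₊₁(ℝⁿ, ℝⁿ ∖ p) → Hₖ(ℝⁿ ∖ p)` is injective
    have hmono : Mono (relativeSingularHomology.δ R M (RVec n) {p}ᶜ k) :=
      (relativeSingularHomology.exact_ofAbsolute_δ R M (X := RVec n) {p}ᶜ k).mono_g
        ((hX (k + 1) (Nat.succ_ne_zero k)).eq_of_src _ _)
    rcases k with _ | k
    · -- degree `1`: the image of `∂` is the kernel of `H₀(ℝⁿ ∖ p) → H₀(ℝⁿ)`, which is zero
      rcases Nat.lt_or_ge n 2 with hn | hn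
      · -- `n = 0`: `ℝ⁰ ∖ p = ∅`, so `H₁(ℝ⁰ | p) ≅ H₁(ℝ⁰) = 0`
        have hn0 : n = 0 := by omega
        subst hn0
        haveI : IsEmpty ↥(({p}ᶜ : Set (RVec 0))) := ⟨fun v => v.2 (Subsingleton.elim _ _)⟩
        haveI := relativeSingularHomology.isIso_ofAbsolute_of_isEmpty R M (X := RVec 0) {p}ᶜ 1
        exact (hX 1 one_ne_zero).of_iso
          (asIso (relativeSingularHomology.ofAbsolute R M (RVec 0) {p}ᶜ 1)).symm
      · haveI := pathConnectedSpace_compl_singleton_rvec p hn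
        haveI := singularHomology.mono_map_zero_of_pathConnectedSpace R M
          (subsetIncl (({p}ᶜ : Set (RVec n))))
        have hzero : relativeSingularHomology.δ R M (RVec n) {p}ᶜ 0 = 0 := by
          rw [← cancel_mono (singularHomology.map R M (subsetIncl (({p}ᶜ : Set (RVec n)))) 0),
            relativeSingularHomology.δ_comp_map, zero_comp]
        exact IsZero.of_mono_eq_zero _ hzero
    · -- degree `k + 2 ≥ 2`: `Hₖ₊₁(ℝⁿ ∖ p) = 0` since `k + 2 ≠ n`
      exact IsZero.of_mono (relativeSingularHomology.δ R M (RVec n) {p}ᶜ (k + 1))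
        (isZero_singularHomology_compl_singleton_rvec R M p (Nat.succ_pos k) (by omega))

end Euclidean

/-! ### Transport along charts -/

section Charts

variable {X : Type} [TopologicalSpace X] [T1Space X]

/-- **`Hₖ(X | x; M) = 0` for `k ≠ n` at every point of a chart `e : X ⇀ ℝⁿ`** (Hatcher 2002,
§3.3, p. 231): `Hₖ(X | x) ≅ Hₖ(e.source | x) ≅ Hₖ(e.target | e x) ≅ Hₖ(ℝⁿ | e x) = 0` by excision
twice, the homeomorphism `e.source ≃ₜ e.target`, and `Literature.AlgebraicTopology.SingularHomology.isZero_localHomology_rvec`.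
[cite: HatcherAT2002, §3.3 p. 231] -/
theorem isZero_localHomology_of_chart {n : ℕ} (e : OpenPartialHomeomorph X (RVec n)) {x : X}
    (hx : x ∈ e.source) {k : ℕ} (hk : k ≠ n) : IsZero (localHomology R M X x k) := by
  have h1 : IsZero (localHomology R M (↥e.target) (e.toHomeomorphSourceTarget ⟨x, hx⟩) k) :=
    (isZero_localHomology_rvec R M (e x) hk).of_iso
      (localHomology.openSubsetIso R M e.open_target (e.map_source hx) k)
  exact (h1.of_iso (localHomology.mapIso R M e.toHomeomorphSourceTarget ⟨x, hx⟩ k)).of_iso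
    (localHomology.openSubsetIso R M e.open_source hx k).symm

/-- **Discharge of the named fact `Literature.AlgebraicTopology.SingularHomology.isZero_localHomology` for spaces `X : Type`** (Hatcher
2002, §3.3, p. 231): on a topological `n`-manifold, `Hₖ(X | x; M) = 0` for every point `x` and
every `k ≠ n`, for every commutative ring `R` and `R`-module `M`. [cite: HatcherAT2002, §3.3 p. 231] -/
theorem isZero_localHomology_holds (X : Type) [TopologicalSpace X] :
    isZero_localHomology R M (X := X) := by
  intro n _ _ x k hk
  obtain ⟨e, hx⟩ := clocalHomology.exists_mem_source_rvec X n x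
  exact isZero_localHomology_of_chart R M e hx hk

end Charts

end Literature.AlgebraicTopology.SingularHomology
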